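import Summits.Ventures.PercRepro.Night2HighAssembly

/-!
# night-2: THE HIGH-LEVEL THEOREM WITH THE TOP FOUR LEVELS AT FULL CAPACITY (gen 39)

At a target `Q ∪ Y` with `|W ∖ Y| ≤ 3` the complement has rank `≤ 3`, so an unloaded such target has `vCap = 1`
(gen 37's `vCap_eq_one_of_rkN_sdiff_le_three`) whether or not it is hitting.  Adding ALL the targets of the top four levels
(above the longest line) to the hitting family of Night2HighFair gives
`highIncomeTop N L := Σ_{i ≥ L+3} [N ≤ i + 3 ? C(N, i) · 3 / C(i+5, 4) : (11/18) · (C(N, i) − 5 C(N−2, i))⁺ · 3 / C(i+5, 4)]`,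
and **`basis_pair_fair_of_high_levels_top`**: `1 ≤ highIncomeTop N L` ⇒ fair.  New cells: `(11, 4) = 1.44`, `(10, 3) = 1.34`,
`(9, 3) = 1.02`, `(8, 2) = 1.11`: **no four collinear points of `W` and `|W| ≥ 9` ⇒ fair** (`basis_pair_fair_of_lines_le_three`),
**no three collinear points of `W` and `|W| ≥ 8` ⇒ fair** (`basis_pair_fair_of_lines_le_two`), and `|W| = 11` with at most four
collinear points (`basis_pair_fair_of_eleven_lines_le_four`).  Paper: proofs/NIGHT-2-g39.md §3.
-/

namespace PercRepro.Shadow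

open PercRepro.ThmH PercRepro.PerFlat

variable {α : Type*} [DecidableEq α] {M : Matroid α} [M.Finite] {G : Finset α}

/-- The high-level income with the top four levels at full capacity. -/
noncomputable def highIncomeTop (N L : ℕ) : ℚ :=
  ∑ i ∈ Finset.range (N + 1), if L + 3 ≤ i then
    (if N ≤ i + 3 then ((N.choose i : ℕ) : ℚ) * 3 / (((i + 5).choose 4 : ℕ) : ℚ)
      else 11 / 18 * max 0 (((N.choose i : ℕ) : ℚ) - 5 * (((N - 2).choose i : ℕ) : ℚ)) * 3 /
        (((i + 5).choose 4 : ℕ) : ℚ))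
  else 0

/-- Every summand of `highIncomeTop` is nonnegative. -/
theorem highIncomeTop_term_nonneg (N L j : ℕ) :
    (0 : ℚ) ≤ (if L + 3 ≤ j then
      (if N ≤ j + 3 then ((N.choose j : ℕ) : ℚ) * 3 / (((j + 5).choose 4 : ℕ) : ℚ)
        else 11 / 18 * max 0 (((N.choose j : ℕ) : ℚ) - 5 * (((N - 2).choose j : ℕ) : ℚ)) * 3 /
          (((j + 5).choose 4 : ℕ) : ℚ))
      else 0) := by
  split_ifs
  · positivity
  · positivity
  · exact le_rfl

/-- `highIncomeTop` is antitone in `L`. -/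
theorem highIncomeTop_anti_right (N : ℕ) {L L' : ℕ} (h : L ≤ L') : highIncomeTop N L' ≤ highIncomeTop N L := by
  unfold highIncomeTop
  apply Finset.sum_le_sum
  intro i _
  by_cases h1 : L' + 3 ≤ i
  · rw [if_pos h1, if_pos (show L + 3 ≤ i by omega)]
  · rw [if_neg h1]
    split_ifs
    · positivity
    · positivity
    · exact le_rfl

/-- **The per-target bound of the top-or-hitting family**: `1` at the top four levels, `11/18` at a hitting target. -/
theorem high_top_term (hG : G ∈ flatsQ M (5 + 1)) (hd : (gr M \ G).card = 2)
    (hk : kColoops M G = 1) (hs : ∀ e ∈ gr M, ∀ f ∈ gr M, e ≠ f → rkN M {e, f} = 2)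
    (hl : ∀ e ∈ gr M, M.Indep {e}) (hnf : fatClosures M 5 G 2 = ∅) {B : Finset α}
    (hB : B ∈ thinMembers M 5 G) (hnP : ¬ bigP M G B) {z : α} (hz : z ∈ G \ clF M B)
    (hl0 : loss M 5 G B z ≠ 0) {L : ℕ} (hL1 : 1 ≤ L)
    (hL : ∀ x ∈ G, ∀ y ∈ G, x ≠ y → ((G \ insert z B) ∩ clF M {x, y}).card ≤ L)
    {Y : Finset α} (hYW : Y ⊆ G \ insert z B) (hYc : L + 3 ≤ Y.card)
    (hYtop : (G \ insert z B).card ≤ Y.card + 3 ∨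
      ∀ w ∈ (insert z B \ coloops M G).filter (fun w => faceOk M G (insert z B) w),
        ¬ Y ⊆ clF M ((insert z B).erase w)) :
    (if (G \ insert z B).card ≤ Y.card + 3 then (1 : ℚ) else 11 / 18) * 3 /
      (((Y.card + 5).choose 4 : ℕ) : ℚ) ≤ vCap M G (insert z B ∪ Y) / faceSum M G (insert z B ∪ Y) := by
  have hfat : (fatClosures M 5 G 2).card ≤ 1 := by
    rw [hnf, Finset.card_empty]
    exact zero_le_one
  have hQG : insert z B ⊆ G :=
    Finset.insert_subset (Finset.mem_sdiff.1 hz).1 (subset_G_of_mem_thinMembers hB)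
  have hT : insert z B ∪ Y ∈ tgtSets M 5 G B z := by
    rw [tgtSets_eq_image hG (mem_thinMembers.1 hB).1 hz, Finset.mem_image]
    refine ⟨Y, Finset.mem_filter.2 ⟨Finset.mem_powerset.2 hYW, ?_⟩, rfl⟩
    rw [← Finset.card_pos]
    omega
  have hTG : insert z B ∪ Y ⊆ G := Finset.union_subset hQG (hYW.trans Finset.sdiff_subset)
  have hne : Y.Nonempty := by
    rw [← Finset.card_pos]
    omega
  have hdl := dload_eq_zero_of_level_of_lines_le hG hd hk hs hl hfat hB hnP hz hL1 hL hYW hYc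
  have hpos := faceSum_pos_of_mem_tgtSets hG hd hk hB hnP hz hl0 hT
  have hfs := faceSum_le_third_mul_choose hG hd hk hnf hTG
  rw [card_union_sdiff_coloops_eq hG hd hk hB hnP hz hYW, add_comm] at hfs
  have hC : (0 : ℚ) < (((Y.card + 5).choose 4 : ℕ) : ℚ) := by
    exact_mod_cast Nat.choose_pos (by omega)
  have hv : (if (G \ insert z B).card ≤ Y.card + 3 then (1 : ℚ) else 11 / 18) ≤
      vCap M G (insert z B ∪ Y) := by
    split_ifs with htop
    · -- the top four levels: the complement `W ∖ Y` has at most three points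
      have hcomp : G \ (insert z B ∪ Y) = (G \ insert z B) \ Y := by
        ext x
        simp only [Finset.mem_sdiff, Finset.mem_union, not_or]
        tauto
      have hcard : ((G \ insert z B) \ Y).card ≤ 3 := by
        have h1 := Finset.card_sdiff_add_card_inter (G \ insert z B) Y
        rw [Finset.inter_eq_right.2 hYW] at h1
        omega
      have hrk : rkN M (G \ (insert z B ∪ Y)) ≤ 3 := by
        rw [hcomp]
        exact le_trans (rkN_le_card _) hcard
      rw [vCap_eq_one_of_rkN_sdiff_le_three hd hdl hrk]
    · rcases hYtop with h | hhit
      · exact absurd h htop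
      · exact vCap_ge_of_hitting hG hd hk hB hnP hz hYW hne hdl hhit
  rw [div_le_div_iff₀ hC hpos]
  have hv0 : (0 : ℚ) ≤ (if (G \ insert z B).card ≤ Y.card + 3 then (1 : ℚ) else 11 / 18) := by
    split_ifs <;> norm_num
  nlinarith

omit [DecidableEq α] in
/-- **The abstract regrouping**: over the family `{Y ⊆ W : |Y| ≥ L + 3, |W| ≤ |Y| + 3 ∨ P Y}`, if the `P`-subsets of size `i`
below the top levels number `≥ C(|W|, i) − 5 C(|W| − 2, i)`, then
`Σ (|W| ≤ |Y| + 3 ? 1 : 11/18) · 3 / C(|Y| + 5, 4) ≥ highIncomeTop |W| L`. -/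
theorem highIncomeTop_le_sum_filter (W : Finset α) (P : Finset α → Prop) [DecidablePred P] (L : ℕ)
    (hcount : ∀ i, L + 3 ≤ i → ¬ W.card ≤ i + 3 →
      ((W.card.choose i : ℕ) : ℚ) - 5 * (((W.card - 2).choose i : ℕ) : ℚ) ≤
        (((W.powersetCard i).filter P).card : ℚ)) :
    highIncomeTop W.card L ≤
      ∑ Y ∈ W.powerset.filter (fun Y => L + 3 ≤ Y.card ∧ (W.card ≤ Y.card + 3 ∨ P Y)),
        (if W.card ≤ Y.card + 3 then (1 : ℚ) else 11 / 18) * 3 / (((Y.card + 5).choose 4 : ℕ) : ℚ) := by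
  set fam : Finset (Finset α) := W.powerset.filter (fun Y => L + 3 ≤ Y.card ∧ (W.card ≤ Y.card + 3 ∨ P Y))
    with hfam
  have hmaps : ∀ Y ∈ fam, Y.card ∈ Finset.range (W.card + 1) := fun Y hY =>
    Finset.mem_range.2 (Nat.lt_succ_of_le (Finset.card_le_card
      (Finset.mem_powerset.1 (Finset.mem_filter.1 hY).1)))
  have hfiber := Finset.sum_fiberwise_of_maps_to hmaps
    (fun Y => (if W.card ≤ Y.card + 3 then (1 : ℚ) else 11 / 18) * 3 / (((Y.card + 5).choose 4 : ℕ) : ℚ))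
  rw [← hfiber]
  unfold highIncomeTop
  apply Finset.sum_le_sum
  intro i _
  have hfib : ∑ Y ∈ fam.filter (fun Y => Y.card = i),
      (if W.card ≤ Y.card + 3 then (1 : ℚ) else 11 / 18) * 3 / (((Y.card + 5).choose 4 : ℕ) : ℚ) =
      ((fam.filter (fun Y => Y.card = i)).card : ℚ) *
        ((if W.card ≤ i + 3 then (1 : ℚ) else 11 / 18) * 3 / (((i + 5).choose 4 : ℕ) : ℚ)) := by
    rw [Finset.sum_congr rfl (fun Y hY => by rw [(Finset.mem_filter.1 hY).2])]
    rw [Finset.sum_const, nsmul_eq_mul]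
  rw [hfib]
  split_ifs with hLi htop
  · -- the top four levels: every `i`-subset is in the family
    have hsub : W.powersetCard i ⊆ fam.filter (fun Y => Y.card = i) := by
      intro Y hY
      rw [Finset.mem_powersetCard] at hY
      rw [Finset.mem_filter, hfam, Finset.mem_filter, Finset.mem_powerset]
      exact ⟨⟨hY.1, by omega, Or.inl (by omega)⟩, hY.2⟩
    have hcard : ((W.card.choose i : ℕ) : ℚ) ≤ ((fam.filter (fun Y => Y.card = i)).card : ℚ) := by
      rw [← Finset.card_powersetCard]
      exact_mod_cast Finset.card_le_card hsub
    have hC : (0 : ℚ) ≤ 3 / (((i + 5).choose 4 : ℕ) : ℚ) := by positivity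
    calc ((W.card.choose i : ℕ) : ℚ) * 3 / (((i + 5).choose 4 : ℕ) : ℚ)
        = ((W.card.choose i : ℕ) : ℚ) * (3 / (((i + 5).choose 4 : ℕ) : ℚ)) := by ring
      _ ≤ ((fam.filter (fun Y => Y.card = i)).card : ℚ) * (3 / (((i + 5).choose 4 : ℕ) : ℚ)) :=
          mul_le_mul_of_nonneg_right hcard hC
      _ = ((fam.filter (fun Y => Y.card = i)).card : ℚ) * (1 * 3 / (((i + 5).choose 4 : ℕ) : ℚ)) := by ring
  · -- a lower level: the `P`-subsets
    have hsub : (W.powersetCard i).filter P ⊆ fam.filter (fun Y => Y.card = i) := by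
      intro Y hY
      rw [Finset.mem_filter, Finset.mem_powersetCard] at hY
      obtain ⟨⟨hYW, hYi⟩, hP⟩ := hY
      rw [Finset.mem_filter, hfam, Finset.mem_filter, Finset.mem_powerset]
      exact ⟨⟨hYW, by omega, Or.inr hP⟩, hYi⟩
    have hcard : (((W.powersetCard i).filter P).card : ℚ) ≤ ((fam.filter (fun Y => Y.card = i)).card : ℚ) := by
      exact_mod_cast Finset.card_le_card hsub
    have hC : (0 : ℚ) ≤ 11 / 18 * 3 / (((i + 5).choose 4 : ℕ) : ℚ) := by positivity
    have hmax : max 0 (((W.card.choose i : ℕ) : ℚ) - 5 * (((W.card - 2).choose i : ℕ) : ℚ)) ≤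
        ((fam.filter (fun Y => Y.card = i)).card : ℚ) :=
      max_le (by positivity) (le_trans (hcount i hLi htop) hcard)
    calc 11 / 18 * max 0 (((W.card.choose i : ℕ) : ℚ) - 5 * (((W.card - 2).choose i : ℕ) : ℚ)) * 3 /
          (((i + 5).choose 4 : ℕ) : ℚ)
        = max 0 (((W.card.choose i : ℕ) : ℚ) - 5 * (((W.card - 2).choose i : ℕ) : ℚ)) *
            (11 / 18 * 3 / (((i + 5).choose 4 : ℕ) : ℚ)) := by ring
      _ ≤ ((fam.filter (fun Y => Y.card = i)).card : ℚ) * (11 / 18 * 3 / (((i + 5).choose 4 : ℕ) : ℚ)) :=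
          mul_le_mul_of_nonneg_right hmax hC
  all_goals positivity

/-- **The top-or-hitting targets above the longest line are targets, and their income is at least
`highIncomeTop N L`.** -/
theorem high_top_targets_subset_and_income (hG : G ∈ flatsQ M (5 + 1)) (hd : (gr M \ G).card = 2)
    (hk : kColoops M G = 1) (hs : ∀ e ∈ gr M, ∀ f ∈ gr M, e ≠ f → rkN M {e, f} = 2)
    (hl : ∀ e ∈ gr M, M.Indep {e}) (hnf : fatClosures M 5 G 2 = ∅) {B : Finset α}
    (hB : B ∈ thinMembers M 5 G) (hnP : ¬ bigP M G B) {z : α} (hz : z ∈ G \ clF M B)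
    (hl0 : loss M 5 G B z ≠ 0) {L : ℕ} (hL1 : 1 ≤ L)
    (hL : ∀ x ∈ G \ insert z B, ∀ y ∈ G \ insert z B, x ≠ y →
      ((G \ insert z B) ∩ clF M {x, y}).card ≤ L) :
    (((G \ insert z B).powerset.filter (fun Y => L + 3 ≤ Y.card ∧ ((G \ insert z B).card ≤ Y.card + 3 ∨
        ∀ w ∈ (insert z B \ coloops M G).filter (fun w => faceOk M G (insert z B) w),
          ¬ Y ⊆ clF M ((insert z B).erase w)))).image (fun Y => insert z B ∪ Y)) ⊆ tgtSets M 5 G B z ∧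
      highIncomeTop (G \ insert z B).card L ≤
        ∑ T ∈ ((G \ insert z B).powerset.filter (fun Y => L + 3 ≤ Y.card ∧ ((G \ insert z B).card ≤ Y.card + 3 ∨
          ∀ w ∈ (insert z B \ coloops M G).filter (fun w => faceOk M G (insert z B) w),
            ¬ Y ⊆ clF M ((insert z B).erase w)))).image (fun Y => insert z B ∪ Y),
          vCap M G T / faceSum M G T := by
  have hL' := lines_le_of_pairs_le hs hG hL1 hL
  set fam : Finset (Finset α) := (G \ insert z B).powerset.filter (fun Y => L + 3 ≤ Y.card ∧
    ((G \ insert z B).card ≤ Y.card + 3 ∨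
      ∀ w ∈ (insert z B \ coloops M G).filter (fun w => faceOk M G (insert z B) w),
        ¬ Y ⊆ clF M ((insert z B).erase w))) with hfam
  set 𝒯 : Finset (Finset α) := fam.image (fun Y => insert z B ∪ Y) with h𝒯
  have hmem : ∀ Y ∈ fam, Y ⊆ G \ insert z B ∧ L + 3 ≤ Y.card ∧ ((G \ insert z B).card ≤ Y.card + 3 ∨
      ∀ w ∈ (insert z B \ coloops M G).filter (fun w => faceOk M G (insert z B) w),
        ¬ Y ⊆ clF M ((insert z B).erase w)) := by
    intro Y hY
    rw [hfam, Finset.mem_filter, Finset.mem_powerset] at hY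
    exact ⟨hY.1, hY.2.1, hY.2.2⟩
  -- the targets
  have h𝒯sub : 𝒯 ⊆ tgtSets M 5 G B z := by
    intro T hT
    rw [h𝒯, Finset.mem_image] at hT
    obtain ⟨Y, hY, rfl⟩ := hT
    obtain ⟨hYW, hYc, -⟩ := hmem Y hY
    rw [tgtSets_eq_image hG (mem_thinMembers.1 hB).1 hz, Finset.mem_image]
    refine ⟨Y, Finset.mem_filter.2 ⟨Finset.mem_powerset.2 hYW, ?_⟩, rfl⟩
    rw [← Finset.card_pos]
    omega
  -- injectivity
  have hinj : Set.InjOn (fun Y => insert z B ∪ Y) (fam : Set (Finset α)) := by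
    intro Y₁ hY₁ Y₂ hY₂ heq
    rw [Finset.mem_coe] at hY₁ hY₂
    have key : ∀ Y ∈ fam, (insert z B ∪ Y) ∩ (G \ insert z B) = Y := by
      intro Y hY
      ext x
      rw [Finset.mem_inter, Finset.mem_union]
      constructor
      · rintro ⟨hx | hx, hxW⟩
        · exact absurd hx (Finset.mem_sdiff.1 hxW).2
        · exact hx
      · intro hx
        exact ⟨Or.inr hx, (hmem Y hY).1 hx⟩
    have h1 := key Y₁ hY₁
    have h2 := key Y₂ hY₂
    simp only at heq
    rw [← h1, ← h2, heq]
  -- the per-target bound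
  have hterm : ∀ Y ∈ fam, (if (G \ insert z B).card ≤ Y.card + 3 then (1 : ℚ) else 11 / 18) * 3 /
      (((Y.card + 5).choose 4 : ℕ) : ℚ) ≤ vCap M G (insert z B ∪ Y) / faceSum M G (insert z B ∪ Y) := by
    intro Y hY
    obtain ⟨hYW, hYc, hYtop⟩ := hmem Y hY
    exact high_top_term hG hd hk hs hl hnf hB hnP hz hl0 hL1 hL' hYW hYc hYtop
  -- the sum over the targets
  have hsum𝒯 : ∑ Y ∈ fam, (if (G \ insert z B).card ≤ Y.card + 3 then (1 : ℚ) else 11 / 18) * 3 /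
      (((Y.card + 5).choose 4 : ℕ) : ℚ) ≤ ∑ T ∈ 𝒯, vCap M G T / faceSum M G T := by
    rw [h𝒯, Finset.sum_image hinj]
    exact Finset.sum_le_sum hterm
  refine ⟨h𝒯sub, le_trans ?_ hsum𝒯⟩
  exact highIncomeTop_le_sum_filter (G \ insert z B) _ L
    (fun i _ _ => card_filter_hitting_ge hG hd hk hnf hB hnP hz i)

/-- **THE HIGH-LEVEL THEOREM WITH THE TOP LEVELS AT FULL CAPACITY**: `1 ≤ highIncomeTop |W| L` ⇒ fair. -/
theorem basis_pair_fair_of_high_levels_top (hG : G ∈ flatsQ M (5 + 1)) (hd : (gr M \ G).card = 2)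
    (hk : kColoops M G = 1) (hs : ∀ e ∈ gr M, ∀ f ∈ gr M, e ≠ f → rkN M {e, f} = 2)
    (hl : ∀ e ∈ gr M, M.Indep {e}) (hnf : fatClosures M 5 G 2 = ∅) {B : Finset α}
    (hB : B ∈ thinMembers M 5 G) (hnP : ¬ bigP M G B) {z : α} (hz : z ∈ G \ clF M B)
    (hl0 : loss M 5 G B z ≠ 0) {L : ℕ} (hL1 : 1 ≤ L)
    (hL : ∀ x ∈ G \ insert z B, ∀ y ∈ G \ insert z B, x ≠ y →
      ((G \ insert z B) ∩ clF M {x, y}).card ≤ L)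
    (hsum : 1 ≤ highIncomeTop (G \ insert z B).card L) :
    loss M 5 G B z ≤ rhoL M 5 G B z * lossIncomeH M 5 G (bigP M G) (dshGT2 M 5 G) B z := by
  have hfat : (fatClosures M 5 G 2).card ≤ 1 := by
    rw [hnf, Finset.card_empty]
    exact zero_le_one
  obtain ⟨hsub, hinc⟩ := high_top_targets_subset_and_income hG hd hk hs hl hnf hB hnP hz hl0 hL1 hL
  exact basis_pair_fair_of_vCap_face_sum_subfamily hG hd hk hs hl hfat hB hnP hz hl0 hsub (hsum.trans hinc)

/-- `highIncomeTop 11 4 ≥ 1` (`1.44`). -/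
theorem one_le_highIncomeTop_eleven_four : 1 ≤ highIncomeTop 11 4 := by
  unfold highIncomeTop
  simp only [Finset.sum_range_succ, Finset.sum_range_zero]
  norm_num [Nat.choose, max_def]

/-- `highIncomeTop 10 3 ≥ 1` (`1.34`). -/
theorem one_le_highIncomeTop_ten_three : 1 ≤ highIncomeTop 10 3 := by
  unfold highIncomeTop
  simp only [Finset.sum_range_succ, Finset.sum_range_zero]
  norm_num [Nat.choose, max_def]

/-- `highIncomeTop 9 3 ≥ 1` (`1.02`). -/
theorem one_le_highIncomeTop_nine_three : 1 ≤ highIncomeTop 9 3 := by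
  unfold highIncomeTop
  simp only [Finset.sum_range_succ, Finset.sum_range_zero]
  norm_num [Nat.choose, max_def]

/-- `highIncomeTop 8 2 ≥ 1` (`1.11`). -/
theorem one_le_highIncomeTop_eight_two : 1 ≤ highIncomeTop 8 2 := by
  unfold highIncomeTop
  simp only [Finset.sum_range_succ, Finset.sum_range_zero]
  norm_num [Nat.choose, max_def]

/-- **No four collinear points of `W` and `|W| ≥ 9` ⇒ fair** (`|W| ≥ 12` unconditionally). -/
theorem basis_pair_fair_of_lines_le_three (hG : G ∈ flatsQ M (5 + 1)) (hd : (gr M \ G).card = 2)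
    (hk : kColoops M G = 1) (hs : ∀ e ∈ gr M, ∀ f ∈ gr M, e ≠ f → rkN M {e, f} = 2)
    (hl : ∀ e ∈ gr M, M.Indep {e}) (hnf : fatClosures M 5 G 2 = ∅) {B : Finset α}
    (hB : B ∈ thinMembers M 5 G) (hnP : ¬ bigP M G B) {z : α} (hz : z ∈ G \ clF M B)
    (hl0 : loss M 5 G B z ≠ 0)
    (hL : ∀ x ∈ G \ insert z B, ∀ y ∈ G \ insert z B, x ≠ y →
      ((G \ insert z B) ∩ clF M {x, y}).card ≤ 3)
    (hN : 9 ≤ (G \ insert z B).card) :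
    loss M 5 G B z ≤ rhoL M 5 G B z * lossIncomeH M 5 G (bigP M G) (dshGT2 M 5 G) B z := by
  rcases Nat.lt_or_ge (G \ insert z B).card 12 with hlt | hge
  · apply basis_pair_fair_of_high_levels_top hG hd hk hs hl hnf hB hnP hz hl0 (by norm_num) hL
    rcases Nat.lt_or_ge (G \ insert z B).card 10 with h9 | h10
    · rw [show (G \ insert z B).card = 9 by omega]
      exact one_le_highIncomeTop_nine_three
    · rcases Nat.lt_or_ge (G \ insert z B).card 11 with h10' | h11
      · rw [show (G \ insert z B).card = 10 by omega]
        exact one_le_highIncomeTop_ten_three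
      · rw [show (G \ insert z B).card = 11 by omega]
        exact le_trans one_le_highIncomeTop_eleven_four (highIncomeTop_anti_right 11 (by norm_num))
  · exact basis_pair_fair_of_twelve hG hd hk hs hl hnf hB hnP hz hl0 hge

/-- **No three collinear points of `W` and `|W| ≥ 8` ⇒ fair.** -/
theorem basis_pair_fair_of_lines_le_two (hG : G ∈ flatsQ M (5 + 1)) (hd : (gr M \ G).card = 2)
    (hk : kColoops M G = 1) (hs : ∀ e ∈ gr M, ∀ f ∈ gr M, e ≠ f → rkN M {e, f} = 2)
    (hl : ∀ e ∈ gr M, M.Indep {e}) (hnf : fatClosures M 5 G 2 = ∅) {B : Finset α}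
    (hB : B ∈ thinMembers M 5 G) (hnP : ¬ bigP M G B) {z : α} (hz : z ∈ G \ clF M B)
    (hl0 : loss M 5 G B z ≠ 0)
    (hL : ∀ x ∈ G \ insert z B, ∀ y ∈ G \ insert z B, x ≠ y →
      ((G \ insert z B) ∩ clF M {x, y}).card ≤ 2)
    (hN : 8 ≤ (G \ insert z B).card) :
    loss M 5 G B z ≤ rhoL M 5 G B z * lossIncomeH M 5 G (bigP M G) (dshGT2 M 5 G) B z := by
  rcases Nat.lt_or_ge (G \ insert z B).card 9 with hlt | hge
  · apply basis_pair_fair_of_high_levels_top hG hd hk hs hl hnf hB hnP hz hl0 (by norm_num) hL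
    rw [show (G \ insert z B).card = 8 by omega]
    exact one_le_highIncomeTop_eight_two
  · exact basis_pair_fair_of_lines_le_three hG hd hk hs hl hnf hB hnP hz hl0
      (fun x hx y hy hxy => le_trans (hL x hx y hy hxy) (by norm_num)) hge

/-- **`|W| = 11` with at most four collinear points of `W` ⇒ fair.** -/
theorem basis_pair_fair_of_eleven_lines_le_four (hG : G ∈ flatsQ M (5 + 1)) (hd : (gr M \ G).card = 2)
    (hk : kColoops M G = 1) (hs : ∀ e ∈ gr M, ∀ f ∈ gr M, e ≠ f → rkN M {e, f} = 2)
    (hl : ∀ e ∈ gr M, M.Indep {e}) (hnf : fatClosures M 5 G 2 = ∅) {B : Finset α}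
    (hB : B ∈ thinMembers M 5 G) (hnP : ¬ bigP M G B) {z : α} (hz : z ∈ G \ clF M B)
    (hl0 : loss M 5 G B z ≠ 0)
    (hL : ∀ x ∈ G \ insert z B, ∀ y ∈ G \ insert z B, x ≠ y →
      ((G \ insert z B) ∩ clF M {x, y}).card ≤ 4)
    (hN : (G \ insert z B).card = 11) :
    loss M 5 G B z ≤ rhoL M 5 G B z * lossIncomeH M 5 G (bigP M G) (dshGT2 M 5 G) B z := by
  apply basis_pair_fair_of_high_levels_top hG hd hk hs hl hnf hB hnP hz hl0 (by norm_num) hL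
  rw [hN]
  exact one_le_highIncomeTop_eleven_four

end PercRepro.Shadow
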